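import Summits.Ventures.HodgeRepro2.T5FinitePlaceCMDecomp

/-!
# The two local conjugations coincide: `decompAut c = extendAut c` at a `c`-fixed place
(cell pub-hodge-repro2, seat p3)

Tier-5 N2 support, §N2.9.2 of route/T5-N2-route-3.md («completions») at the finite places — a coherence lemma.
File 117 builds the local conjugation of `E_w` over `F_v` ALGEBRAICALLY (`extendAutOfNotIsSquare c`, through
`E_w = F_v ⊗_F E`, available when `θ` is not a `v`-adic square); file 121 builds it TOPOLOGICALLY (`decompAut c`,
the continuous extension of `c`, available when `c • w = w`). When `c • w = w` both exist (file 121: `θ` is then not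
a `v`-adic square) and they are the SAME map (`decompAut_eq_extendAutOfNotIsSquare`): both are continuous
(`extendAut` is `F_v`-linear on a finite-dimensional space over the complete field `F_v`), both restrict to `c`
on the dense subfield `E`. CM form: `decompAut (complexConj K) = localComplexConj` (`decompAut_eq_localComplexConj`),
so file 120's star-structure on `K_w` is the continuous extension of Mathlib's CM conjugation whenever `c` fixes `w`.
Mathlib + files 117, 120–122 only. No display; no device. §8(d): uses an L-value-free non-vanishing device: NO.
-/

namespace Summit.Ventures.HodgeRepro2.T5FinitePlaceDecompCoherence

open IsDedekindDomain IsDedekindDomain.HeightOneSpectrum NumberField NumberField.IsCMField Module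
open scoped Summit.Ventures.HodgeRepro2.T5FinitePlaceLiesOver Pointwise Valued
open Summit.Ventures.HodgeRepro2.T5FinitePlaceLiesOver Summit.Ventures.HodgeRepro2.T5FinitePlaceQuadratic
  Summit.Ventures.HodgeRepro2.T5FinitePlaceTensorEquiv Summit.Ventures.HodgeRepro2.T5FinitePlaceDecompAut
  Summit.Ventures.HodgeRepro2.T5FinitePlaceCM Summit.Ventures.HodgeRepro2.T5FinitePlaceCMDecomp

section General

variable {K L : Type*} [Field K] [NumberField K] [Field L] [NumberField L] [Algebra K L]
variable (v : HeightOneSpectrum (𝓞 K)) (w : HeightOneSpectrum (𝓞 L)) [w.asIdeal.LiesOver v.asIdeal]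

/-- A `Kᵥ`-algebra automorphism of `L_w` is continuous (`L_w` is finite-dimensional over the complete field `Kᵥ`). -/
theorem continuous_algEquiv (e : w.adicCompletion L ≃ₐ[v.adicCompletion K] w.adicCompletion L) :
    Continuous e :=
  haveI := finite v w
  e.toLinearMap.continuous_of_finiteDimensional

/-- **Two continuous ring maps `L_w → L_w` agreeing on `L` are equal.** -/
theorem ringHom_ext_of_continuous {f g : w.adicCompletion L →+* w.adicCompletion L} (hf : Continuous f)
    (hg : Continuous g) (h : ∀ x : L, f (algebraMap L (w.adicCompletion L) x) = g (algebraMap L (w.adicCompletion L) x)) :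
    f = g := by
  have hd : DenseRange (algebraMap L (w.adicCompletion L)) := denseRange_algebraMap (K := L) (v := w)
  exact DFunLike.coe_injective (hd.equalizer hf hg (funext h))

/-- **`decompAut σ = extendAut σ`** whenever both are defined (`σ • w = w` and `[L_w : Kᵥ] = [L : K]`). -/
theorem decompAut_eq_extendAut (σ : L ≃ₐ[K] L) (hw : σ • w.asIdeal = w.asIdeal)
    (h : finrank (v.adicCompletion K) (w.adicCompletion L) = finrank K L) (z : w.adicCompletion L) :
    decompAut w σ hw z = extendAut v w h σ z := by
  have := ringHom_ext_of_continuous w (f := decompAut w σ hw)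
    (g := (extendAut v w h σ : w.adicCompletion L →+* w.adicCompletion L)) (continuous_decompAut w σ hw)
    (continuous_algEquiv v w (extendAut v w h σ)) fun x => by
      show decompAut w σ hw (algebraMap L _ x) = extendAut v w h σ (algebraMap L _ x)
      rw [extendAut_algebraMap]
      exact decompAut_coe w σ hw x
  exact congrArg (fun f => f z) this

end General

section Quadratic

variable {F E : Type*} [Field F] [NumberField F] [Field E] [NumberField E] [Algebra F E]
  [Algebra.IsQuadraticExtension F E]
variable (v : HeightOneSpectrum (𝓞 F)) (w : HeightOneSpectrum (𝓞 E)) [w.asIdeal.LiesOver v.asIdeal]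
variable {s : E} {θ : F}

/-- **The algebraic and the topological local conjugation coincide** at a `c`-fixed place. -/
theorem decompAut_eq_extendAutOfNotIsSquare (hs : s ^ 2 = algebraMap F E θ)
    (hspan : Submodule.span F {(1 : E), s} = ⊤) (hs0 : s ≠ 0) (c : E ≃ₐ[F] E) (hc : c s = -s)
    (hw : c • w.asIdeal = w.asIdeal) (z : w.adicCompletion E) :
    decompAut w c hw z =
      extendAutOfNotIsSquare v w hs hspan (not_isSquare_of_smul_eq v w hs hspan hs0 c hc hw) c z :=
  decompAut_eq_extendAut v w c hw _ z

end Quadratic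

section CM

variable (K : Type*) [Field K] [NumberField K] [IsCMField K]
variable {θ : maximalRealSubfield K} {y : K}
variable (hθ : algebraMap (maximalRealSubfield K) K θ = y ^ 2) (hy : complexConj K y ≠ y)
variable (v : HeightOneSpectrum (𝓞 (maximalRealSubfield K))) (w : HeightOneSpectrum (𝓞 K))
  [w.asIdeal.LiesOver v.asIdeal]

/-- **`decompAut (complexConj K) = localComplexConj`** at a `c`-fixed place of the CM field. -/
theorem decompAut_eq_localComplexConj (hw : complexConj K • w.asIdeal = w.asIdeal) (z : w.adicCompletion K) :
    decompAut w (complexConj K) hw z =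
      localComplexConj K hθ hy v w (not_isSquare_of_complexConj_smul_eq K hθ hy v w hw) z :=
  decompAut_eq_extendAut v w (complexConj K) hw _ z

end CM

end Summit.Ventures.HodgeRepro2.T5FinitePlaceDecompCoherence
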